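import Literature.Analysis.Matrix.KyFanMaximumPrinciple

/-!
# A repulsive spectral channel (paramagnons) can only lower the linearised Eliashberg `T_c`

Companion to `EliashbergTcCouplingMonotonicity` (p521505: the attractive coupling scale raises `T_c`)
and to `ParamagnonTcSuppression` (the printed McMillan-class formulas `sfTc`, `dmcTc`). Here the same
statement is proved for the discretised linearised isotropic Migdal–Eliashberg kernel itself: adding,
or scaling up, a REPULSIVE channel with positive semidefinite kernel `Λ_sf ⪰ 0` (spin fluctuations /
paramagnons enter the singlet gap equation with the opposite sign of phonons, Berk–Schrieffer) and a
nonnegative contribution `a^sf ≥ 0` to the mass renormalisation can only SHRINK the super-level set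
`{T | ρ(T) ≥ 1}`, hence only lower `T_c`. This is the kernel-level corner rule for a spin-fluctuation box
(`λ_sf ∈ [s₋, s₊]`: lower band edge at `s₊`, upper at `s₋`) and the monotonicity behind «the `λ_sf`
needed to reach a measured `T_c` is unique».

Model (plain real data on `N` Matsubara indices): phonon matrix `Λ` (symmetric), repulsive-channel matrix
`Λ_sf` (symmetric, `yᵀΛ_sf y ≥ 0`), bare weights `c_n > 0`, phonon mass sums `a_n ≥ 0`, channel mass sums
`b_n ≥ 0`, Coulomb pseudopotential `μ` (any real), channel scale `s ≥ 0`: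
`K(s)_{nm} = (Λ_{nm} − s Λ_sf,nm − μ) / ((c_n + a_n + s b_n)(c_m + a_m + s b_m))^{1/2}`.
With the substitution `x = p(s)^{1/2} y` (as in p521505) the Rayleigh quotient is
`(yᵀΛy − s·yᵀΛ_sf y − μ(Σy)²) / Σ (c_n + a_n + s b_n) y_n²`: the numerator is non-increasing and the
(positive) denominator non-decreasing in `s`, so a quotient `≥ 1` at `s₂` forces a quotient `≥ 1` at every
`s₁ ≤ s₂` (no sign hypothesis on `Λ` or `μ` is needed for the threshold statement).

Proved here:
* `repulsiveKernel`, `isHermitian_repulsiveKernel` — the family `K(s)`;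
* `dotProduct_repulsiveKernel_mulVec` — the substituted Rayleigh numerator;
* `one_le_eigenvalues₀_max_repulsiveKernel_anti` — **if `λ_max(K(s₂)) ≥ 1` and `0 ≤ s₁ ≤ s₂` then
  `λ_max(K(s₁)) ≥ 1`** (the super-level set shrinks as the repulsive channel grows);
* `sSup_superlevel_repulsive_anti` — threshold form: `T_c(s₂) ≤ T_c(s₁)`.

## References
* [BergmannRainer1973] G. Bergmann, D. Rainer, Z. Phys. 263 (1973) 59 — sign of `δT_c/δ(kernel)`.
* [DaamsMitrovicCarbotte1981] J. M. Daams, B. Mitrović, J. P. Carbotte, Phys. Rev. Lett. 46 (1981) 65 —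
  paramagnons in the Eliashberg equations (repulsive in the gap channel, additive in `Z`).
* [HornJohnson2013] R. A. Horn, C. R. Johnson, *Matrix Analysis*, 2nd ed. — Thm. 4.2.2 (Rayleigh).
-/

noncomputable section

open scoped Matrix

namespace Literature.MathematicalPhysics.QuantumManyBody

open Finset _root_.Matrix Literature.Analysis.Matrix

variable {ι : Type*} [Fintype ι] [DecidableEq ι]

/-- **Linearised Eliashberg kernel with a scaled repulsive channel.**
`repulsiveKernel Λ Λsf c a b μ s = ((Λ_nm − s Λsf_nm − μ) / (√p_n(s) √p_m(s)))` with
`p_n(s) = c_n + a_n + s b_n`. [cite: DaamsMitrovicCarbotte1981] -/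
def repulsiveKernel (Λ Λsf : Matrix ι ι ℝ) (c a b : ι → ℝ) (μ s : ℝ) : Matrix ι ι ℝ :=
  Matrix.of fun n m => (Λ n m - s * Λsf n m - μ) /
    (Real.sqrt (c n + a n + s * b n) * Real.sqrt (c m + a m + s * b m))

omit [Fintype ι] [DecidableEq ι] in
/-- `K(s)` is symmetric when `Λ` and `Λ_sf` are. [cite: DaamsMitrovicCarbotte1981] -/
theorem isHermitian_repulsiveKernel {Λ Λsf : Matrix ι ι ℝ} (hΛ : Λ.IsHermitian) (hΛsf : Λsf.IsHermitian)
    (c a b : ι → ℝ) (μ s : ℝ) : (repulsiveKernel Λ Λsf c a b μ s).IsHermitian := by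
  refine Matrix.IsHermitian.ext fun i j => ?_
  have h1 : Λ j i = Λ i j := by simpa using congrFun (congrFun hΛ i) j
  have h2 : Λsf j i = Λsf i j := by simpa using congrFun (congrFun hΛsf i) j
  simp only [repulsiveKernel, Matrix.of_apply, star_trivial, h1, h2, mul_comm]

omit [Fintype ι] [DecidableEq ι] in
/-- Positivity of the weights `p_n(s) = c_n + a_n + s b_n` for `s ≥ 0`. [folklore] -/
private theorem rweight_pos {c a b : ι → ℝ} (hc : ∀ n, 0 < c n) (ha : ∀ n, 0 ≤ a n) (hb : ∀ n, 0 ≤ b n)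
    {s : ℝ} (hs : 0 ≤ s) (n : ι) : 0 < c n + a n + s * b n :=
  add_pos_of_pos_of_nonneg (add_pos_of_pos_of_nonneg (hc n) (ha n)) (mul_nonneg hs (hb n))

omit [DecidableEq ι] in
/-- **Substituted Rayleigh numerator**: for `x_n = p_n(s)^{1/2} y_n`,
`xᵀ K(s) x = yᵀ Λ y − s · yᵀ Λ_sf y − μ (Σ y)²`. [cite: DaamsMitrovicCarbotte1981] -/
theorem dotProduct_repulsiveKernel_mulVec (Λ Λsf : Matrix ι ι ℝ) {c a b : ι → ℝ} (hc : ∀ n, 0 < c n)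
    (ha : ∀ n, 0 ≤ a n) (hb : ∀ n, 0 ≤ b n) (μ : ℝ) {s : ℝ} (hs : 0 ≤ s) (y : ι → ℝ) :
    (fun n => Real.sqrt (c n + a n + s * b n) * y n) ⬝ᵥ repulsiveKernel Λ Λsf c a b μ s *ᵥ
        (fun n => Real.sqrt (c n + a n + s * b n) * y n) =
      y ⬝ᵥ Λ *ᵥ y - s * (y ⬝ᵥ Λsf *ᵥ y) - μ * (∑ n, y n) ^ 2 := by
  have hsq : ∀ n, Real.sqrt (c n + a n + s * b n) ≠ 0 := fun n =>
    (Real.sqrt_pos.mpr (rweight_pos hc ha hb hs n)).ne'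
  simp only [dotProduct, mulVec, repulsiveKernel, Matrix.of_apply, Finset.mul_sum, sq, Finset.sum_mul,
    ← Finset.sum_sub_distrib]
  refine Finset.sum_congr rfl fun n _ => Finset.sum_congr rfl fun m _ => ?_
  have hn' := hsq n
  have hm' := hsq m
  rw [div_mul_eq_mul_div, mul_div_assoc', div_eq_iff (mul_ne_zero hn' hm')]
  ring

omit [DecidableEq ι] in
/-- `xᵀ x = Σ p_n(s) y_n²` for the substituted vector. [folklore] -/
private theorem dotProduct_self_rweight {c a b : ι → ℝ} (hc : ∀ n, 0 < c n) (ha : ∀ n, 0 ≤ a n)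
    (hb : ∀ n, 0 ≤ b n) {s : ℝ} (hs : 0 ≤ s) (y : ι → ℝ) :
    (fun n => Real.sqrt (c n + a n + s * b n) * y n) ⬝ᵥ (fun n => Real.sqrt (c n + a n + s * b n) * y n) =
      ∑ n, (c n + a n + s * b n) * y n ^ 2 := by
  simp only [dotProduct]
  refine Finset.sum_congr rfl fun n _ => ?_
  have h := Real.mul_self_sqrt (rweight_pos hc ha hb hs n).le
  calc Real.sqrt (c n + a n + s * b n) * y n * (Real.sqrt (c n + a n + s * b n) * y n)
        = (Real.sqrt (c n + a n + s * b n) * Real.sqrt (c n + a n + s * b n)) * (y n * y n) := by ring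
    _ = (c n + a n + s * b n) * y n ^ 2 := by rw [h, sq]

/-- **The super-level set shrinks as the repulsive channel grows.** For `Λ_sf ⪰ 0`, `c > 0`, `a, b ≥ 0`,
any `μ`, and `0 ≤ s₁ ≤ s₂`: if the top eigenvalue of `K(s₂)` is `≥ 1` then so is that of `K(s₁)`.
Proof: with the top unit eigenvector `x₂` of `K(s₂)` and `y = x₂ / p(s₂)^{1/2}` the numerator
`N(s) = yᵀΛy − s yᵀΛ_sf y − μ(Σy)²` satisfies `N(s₁) ≥ N(s₂) ≥ Σ p(s₂) y² ≥ Σ p(s₁) y² > 0`, so the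
lifted vector `p(s₁)^{1/2} y` has Rayleigh quotient `≥ 1` for `K(s₁)`.
[cite: BergmannRainer1973] [cite: DaamsMitrovicCarbotte1981] -/
theorem one_le_eigenvalues₀_max_repulsiveKernel_anti {Λ Λsf : Matrix ι ι ℝ} (hΛ : Λ.IsHermitian)
    (hΛsf : Λsf.IsHermitian) (hpsd : ∀ y : ι → ℝ, 0 ≤ y ⬝ᵥ Λsf *ᵥ y) {c a b : ι → ℝ}
    (hc : ∀ n, 0 < c n) (ha : ∀ n, 0 ≤ a n) (hb : ∀ n, 0 ≤ b n) (μ : ℝ) {s₁ s₂ : ℝ} (hs₁ : 0 ≤ s₁)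
    (hs : s₁ ≤ s₂) (hn : 1 ≤ Fintype.card ι)
    (h₂ : 1 ≤ (isHermitian_repulsiveKernel hΛ hΛsf c a b μ s₂).eigenvalues₀ (Fin.castLE hn 0)) :
    1 ≤ (isHermitian_repulsiveKernel hΛ hΛsf c a b μ s₁).eigenvalues₀ (Fin.castLE hn 0) := by
  have hs₂ : 0 ≤ s₂ := hs₁.trans hs
  -- top unit eigenvector of K(s₂)
  obtain ⟨h, horth, -, hsum⟩ :=
    KyFan.exists_frame_sum_rayleigh_eq (isHermitian_repulsiveKernel hΛ hΛsf c a b μ s₂) (k := 1) hn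
  have hxx : h 0 ⬝ᵥ h 0 = 1 := by simpa using horth 0 0
  have hval : h 0 ⬝ᵥ repulsiveKernel Λ Λsf c a b μ s₂ *ᵥ h 0 =
      (isHermitian_repulsiveKernel hΛ hΛsf c a b μ s₂).eigenvalues₀ (Fin.castLE hn 0) := by simpa using hsum
  set x := h 0 with hxdef
  set y : ι → ℝ := fun n => x n / Real.sqrt (c n + a n + s₂ * b n) with hy
  have hx : (fun n => Real.sqrt (c n + a n + s₂ * b n) * y n) = x := by
    funext n
    have hsq : Real.sqrt (c n + a n + s₂ * b n) ≠ 0 :=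
      (Real.sqrt_pos.mpr (rweight_pos hc ha hb hs₂ n)).ne'
    simp only [hy]; field_simp
  -- numerator / denominators
  set α : ℝ := y ⬝ᵥ Λ *ᵥ y with hα
  set σ : ℝ := y ⬝ᵥ Λsf *ᵥ y with hσ
  set β : ℝ := μ * (∑ n, y n) ^ 2 with hβ
  have hσ0 : 0 ≤ σ := hpsd y
  have hD : ∀ s : ℝ, ∑ n, (c n + a n + s * b n) * y n ^ 2 =
      (∑ n, (c n + a n) * y n ^ 2) + s * ∑ n, b n * y n ^ 2 := fun s => by
    rw [Finset.mul_sum, ← Finset.sum_add_distrib]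
    refine Finset.sum_congr rfl fun n _ => by ring
  set γ : ℝ := ∑ n, (c n + a n) * y n ^ 2 with hγ
  set δ : ℝ := ∑ n, b n * y n ^ 2 with hδ
  have hδ0 : 0 ≤ δ := Finset.sum_nonneg fun n _ => mul_nonneg (hb n) (sq_nonneg _)
  -- at s₂: numerator N₂ = λ_max ≥ 1, denominator = 1
  have hnum₂ : x ⬝ᵥ repulsiveKernel Λ Λsf c a b μ s₂ *ᵥ x = α - s₂ * σ - β := by
    rw [← hx, dotProduct_repulsiveKernel_mulVec Λ Λsf hc ha hb μ hs₂ y]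
  have hden₂ : γ + s₂ * δ = 1 := by
    rw [← hD, ← dotProduct_self_rweight hc ha hb hs₂ y, hx, hxx]
  have hN₂ : 1 ≤ α - s₂ * σ - β := by rw [← hnum₂, hval]; exact h₂
  -- at s₁: lifted vector x₁ = √p(s₁) y
  set x₁ : ι → ℝ := fun n => Real.sqrt (c n + a n + s₁ * b n) * y n with hx₁
  have hnum₁ : x₁ ⬝ᵥ repulsiveKernel Λ Λsf c a b μ s₁ *ᵥ x₁ = α - s₁ * σ - β := by
    rw [hx₁, dotProduct_repulsiveKernel_mulVec Λ Λsf hc ha hb μ hs₁ y]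
  have hden₁ : x₁ ⬝ᵥ x₁ = γ + s₁ * δ := by
    rw [hx₁, dotProduct_self_rweight hc ha hb hs₁ y, hD]
  have hR := KyFan.dotProduct_mulVec_le_eigenvalues₀_max_mul
    (isHermitian_repulsiveKernel hΛ hΛsf c a b μ s₁) hn x₁
  rw [hnum₁, hden₁] at hR
  -- chain: γ + s₁δ ≤ γ + s₂δ = 1 ≤ α − s₂σ − β ≤ α − s₁σ − β ≤ λ₁ (γ + s₁δ)
  have hmono_num : α - s₂ * σ - β ≤ α - s₁ * σ - β := by nlinarith
  have hmono_den : γ + s₁ * δ ≤ γ + s₂ * δ := by nlinarith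
  have hden₁_pos : 0 < γ + s₁ * δ := by
    have : (0 : ℝ) ≤ γ := Finset.sum_nonneg fun n _ =>
      mul_nonneg (add_pos_of_pos_of_nonneg (hc n) (ha n)).le (sq_nonneg _)
    -- γ + s₁δ > 0: from hx/hxx, p(s₂)-weighted sum is 1, and γ carries the positive c part
    -- if γ + s₁δ = 0 then γ = 0 and s₁δ = 0, so y = 0 (c > 0), contradicting γ + s₂δ = 1
    by_contra hle
    push Not at hle
    have hγ0 : γ = 0 := le_antisymm (by nlinarith [mul_nonneg hs₁ hδ0]) this
    have hy0 : ∀ n, y n = 0 := by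
      intro n
      have hterm : ∀ m ∈ Finset.univ, 0 ≤ (c m + a m) * y m ^ 2 := fun m _ =>
        mul_nonneg (add_pos_of_pos_of_nonneg (hc m) (ha m)).le (sq_nonneg _)
      have := (Finset.sum_eq_zero_iff_of_nonneg hterm).mp (by rw [← hγ]; exact hγ0) n (Finset.mem_univ n)
      have hcn : 0 < c n + a n := add_pos_of_pos_of_nonneg (hc n) (ha n)
      have : y n ^ 2 = 0 := by
        rcases mul_eq_zero.mp this with h | h
        · exact absurd h hcn.ne'
        · exact h
      exact pow_eq_zero_iff (n := 2) (by norm_num) |>.mp this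
    have hδ0' : δ = 0 := by
      rw [hδ]; exact Finset.sum_eq_zero fun n _ => by rw [hy0 n]; ring
    rw [hγ0, hδ0', mul_zero, add_zero] at hden₂
    exact absurd hden₂ (by norm_num)
  set L₁ := (isHermitian_repulsiveKernel hΛ hΛsf c a b μ s₁).eigenvalues₀ (Fin.castLE hn 0)
  have hchain : 1 * (γ + s₁ * δ) ≤ L₁ * (γ + s₁ * δ) := by
    calc 1 * (γ + s₁ * δ) ≤ γ + s₂ * δ := by linarith
      _ = 1 := hden₂
      _ ≤ α - s₂ * σ - β := hN₂
      _ ≤ α - s₁ * σ - β := hmono_num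
      _ ≤ L₁ * (γ + s₁ * δ) := hR
  exact le_of_mul_le_mul_right hchain hden₁_pos

/-- **Threshold form: a stronger repulsive channel cannot raise `T_c`.** With temperature-dependent
data and `ρ(T, s) = λ_max(K_T(s))`, for `0 ≤ s₁ ≤ s₂` the super-level set `{T > 0 | 1 ≤ ρ(T, s₂)}` is
contained in `{T > 0 | 1 ≤ ρ(T, s₁)}`, so `sup ≤ sup` whenever the latter is bounded above — the
corner rule of a spin-fluctuation box on the Eliashberg member (lower edge at the larger `λ_sf`).
[cite: DaamsMitrovicCarbotte1981] -/
theorem sSup_superlevel_repulsive_anti {Λ Λsf : ℝ → Matrix ι ι ℝ} (hΛ : ∀ T, (Λ T).IsHermitian)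
    (hΛsf : ∀ T, (Λsf T).IsHermitian) (hpsd : ∀ T (y : ι → ℝ), 0 ≤ y ⬝ᵥ Λsf T *ᵥ y)
    {c : ι → ℝ} (hc : ∀ n, 0 < c n) {a b : ℝ → ι → ℝ} (ha : ∀ T n, 0 ≤ a T n) (hb : ∀ T n, 0 ≤ b T n)
    (μ : ℝ) {s₁ s₂ : ℝ} (hs₁ : 0 ≤ s₁) (hs : s₁ ≤ s₂) (hn : 1 ≤ Fintype.card ι)
    (hbdd : BddAbove {T : ℝ | 0 < T ∧
      1 ≤ (isHermitian_repulsiveKernel (hΛ T) (hΛsf T) c (a T) (b T) μ s₁).eigenvalues₀ (Fin.castLE hn 0)}) :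
    sSup {T : ℝ | 0 < T ∧
        1 ≤ (isHermitian_repulsiveKernel (hΛ T) (hΛsf T) c (a T) (b T) μ s₂).eigenvalues₀ (Fin.castLE hn 0)} ≤
      sSup {T : ℝ | 0 < T ∧
        1 ≤ (isHermitian_repulsiveKernel (hΛ T) (hΛsf T) c (a T) (b T) μ s₁).eigenvalues₀ (Fin.castLE hn 0)} := by
  have hsub : {T : ℝ | 0 < T ∧
        1 ≤ (isHermitian_repulsiveKernel (hΛ T) (hΛsf T) c (a T) (b T) μ s₂).eigenvalues₀ (Fin.castLE hn 0)} ⊆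
      {T : ℝ | 0 < T ∧
        1 ≤ (isHermitian_repulsiveKernel (hΛ T) (hΛsf T) c (a T) (b T) μ s₁).eigenvalues₀ (Fin.castLE hn 0)} :=
    fun T ⟨hT, h1⟩ => ⟨hT, one_le_eigenvalues₀_max_repulsiveKernel_anti (hΛ T) (hΛsf T) (hpsd T) hc (ha T)
      (hb T) μ hs₁ hs hn h1⟩
  by_cases hne : ({T : ℝ | 0 < T ∧
      1 ≤ (isHermitian_repulsiveKernel (hΛ T) (hΛsf T) c (a T) (b T) μ s₂).eigenvalues₀
        (Fin.castLE hn 0)} : Set ℝ).Nonempty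
  · exact csSup_le_csSup hbdd hne hsub
  · rw [Set.not_nonempty_iff_eq_empty] at hne
    rw [hne, Real.sSup_empty]
    exact Real.sSup_nonneg fun T hT => hT.1.le

end Literature.MathematicalPhysics.QuantumManyBody

end
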